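import Summits.MatrixMultiplication.MatrixMultiplication.Theorems.ObstructionCalculusAction

set_option linter.dupNamespace false

/-!
# Torus laws for equations of border-rank type (decomp-mm · lens 3 · gen-9 kernel, landed gen 11)

Support for the aside **`IsobaricCornerEquationsSuffice`** (item `stmt-MatrixMultiplication-31756`) of
`route-MatrixMultiplication-ObstructionDescent`, closed by name in `ObstructionDescentCornerEquations` on top of this module.
In ANY format `ℂ^α ⊗ ℂ^β ⊗ ℂ^γ`, for the set `RV α β γ m` of polynomials vanishing at every tensor of rank `≤ m`:
**L1 support law** (`coeff_eq_zero_of_card_support_le`: every monomial of an equation uses more than `m` coordinates;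
`eq_zero_of_totalDegree_le`), **L2 torus-weight law** (`isoComp_mem_RV`: isobaric components of equations are equations;
`sum_isoComp`; the pointwise isobaric reduction `aeval_eq_zero_of_isobaric`), **L3 table formula**
(`aeval_indicator_eq_sum_coeff_large`: the value at a `0/1` indicator point is a plain coefficient sum).
No proposition is defined («isobaric» is spelled `∃ w, ∀ μ ∈ h.support, wt μ = w`); sorry-free; standard axioms.
[cite: LandsbergGCT2017, §7.1 (p. 218), §8.3.4 (p. 227), Prop. 8.3.4.2; Blaser2013, Lemma 5.4; BurgisserIkenmeyer2011, §3.1]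
-/

noncomputable section

open scoped BigOperators
open Finset

namespace Summit.MatrixMultiplication.MatrixMultiplication.Theorems.ObstructionDescentTorusLaws

open Literature.Computability.AlgebraicComplexity (triad triad_apply tensorRank tensorRank_le_card_of_eq_sum actTensor
  actTensor_apply tensorRestrictsTo_actTensor)

/-! ### 6.0 Vocabulary (general format `ℂ^α ⊗ ℂ^β ⊗ ℂ^γ`) -/
section Vocabulary
variable {α β γ : Type}

/-- A decomposition into triads indexed by a finset bounds the rank by its cardinality. [bookkeeping] -/
theorem tensorRank_le_card_of_eq_finset_sum {t : α → β → γ → ℂ} {σ : Type*} (P : Finset σ)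
    (w : σ → α → ℂ) (u : σ → β → ℂ) (v : σ → γ → ℂ) (h : t = ∑ q ∈ P, triad (w q) (u q) (v q)) :
    tensorRank t ≤ P.card := by
  rw [← Fintype.card_coe P]
  refine tensorRank_le_card_of_eq_sum (σ := ↥P) (fun q => w q) (fun q => u q) (fun q => v q) ?_
  rw [h, ← Finset.sum_coe_sort]

/-- Index of the characters of the maximal torus `T = T_α × T_β × T_γ ⊂ GL(ℂ^α) × GL(ℂ^β) × GL(ℂ^γ)`
(one coordinate per basis vector of each factor). [cite: LandsbergGCT2017, §7.1 (p. 218)] -/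
abbrev WIdx (α β γ : Type) : Type := α ⊕ β ⊕ γ

/-- The torus weight `ε_a + ε_b + ε_c` of the coordinate `x_{(a,b,c)}`. [cite: LandsbergGCT2017, §7.1 (p. 218)] -/
noncomputable def cellWt (p : α × β × γ) : WIdx α β γ →₀ ℕ :=
  Finsupp.single (Sum.inl p.1) 1 + Finsupp.single (Sum.inr (Sum.inl p.2.1)) 1 +
    Finsupp.single (Sum.inr (Sum.inr p.2.2)) 1

/-- The torus weight of a monomial exponent `μ` (equivalently: the three marginals of `μ`). [bookkeeping] -/
noncomputable def wt (μ : (α × β × γ) →₀ ℕ) : WIdx α β γ →₀ ℕ :=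
  μ.sum fun p k => k • cellWt p

/-- Products of monomials. [bookkeeping] -/
theorem prod_monomial {ι σ : Type*} (s : Finset ι) (e : ι → σ →₀ ℕ) (a : ι → ℂ) :
    ∏ i ∈ s, MvPolynomial.monomial (e i) (a i) =
      MvPolynomial.monomial (∑ i ∈ s, e i) (∏ i ∈ s, a i) := by
  classical
  induction s using Finset.induction_on with
  | empty => simp
  | insert i s hi ih =>
    rw [Finset.prod_insert hi, Finset.sum_insert hi, Finset.prod_insert hi, ih, MvPolynomial.monomial_mul]

/-- The torus substitution `x_{(a,b,c)} ↦ t_{abc}·ξ_a η_b ζ_c` sends `c·x^μ` to `c·t^μ·(ξ,η,ζ)^{wt μ}`. [bookkeeping] -/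
theorem aeval_torus_monomial (t : α → β → γ → ℂ) (μ : (α × β × γ) →₀ ℕ) (c : ℂ) :
    MvPolynomial.aeval (fun p : α × β × γ =>
        MvPolynomial.monomial (cellWt p) (t p.1 p.2.1 p.2.2)) (MvPolynomial.monomial μ c) =
      MvPolynomial.monomial (wt μ) (c * μ.prod fun p k => t p.1 p.2.1 p.2.2 ^ k) := by
  classical
  rw [MvPolynomial.aeval_monomial, MvPolynomial.algebraMap_eq, Finsupp.prod]
  simp_rw [MvPolynomial.monomial_pow]
  rw [prod_monomial, MvPolynomial.C_mul_monomial, Finsupp.prod]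
  rfl
end Vocabulary

/-! ### 6.1 Equations of border-rank type on a general format -/
section Equations
variable {α β γ : Type} [Fintype α] [Fintype β] [Fintype γ]

/-- Equations «of border-rank type» on the format `ℂ^α ⊗ ℂ^β ⊗ ℂ^γ`: polynomials in the coordinates
`x_{(a,b,c)}` vanishing at every tensor of rank `≤ m` (the corner format of
`ObstructionDescentCornerEquations` is the case `α = β = γ = Fin n × Fin n`). [cite: LandsbergGCT2017, §8.3.2 (p. 226)] -/
def RV (α β γ : Type) [Fintype α] [Fintype β] [Fintype γ] (m : ℕ) :
    Set (MvPolynomial (α × β × γ) ℂ) :=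
  {h | ∀ t : α → β → γ → ℂ, tensorRank t ≤ m →
      MvPolynomial.aeval (fun p : α × β × γ => t p.1 p.2.1 p.2.2) h = 0}

variable {m : ℕ}

/-- Membership in `RV`, unfolded. [bookkeeping] -/
theorem mem_RV {h : MvPolynomial (α × β × γ) ℂ} : h ∈ RV α β γ m ↔
    ∀ t : α → β → γ → ℂ, tensorRank t ≤ m →
      MvPolynomial.aeval (fun p : α × β × γ => t p.1 p.2.1 p.2.2) h = 0 := Iff.rfl

/-- Equations form a linear subspace (here: closed under finite sums). [bookkeeping] -/
theorem sum_mem_RV {ι : Type*} (s : Finset ι) (f : ι → MvPolynomial (α × β × γ) ℂ)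
    (hf : ∀ i ∈ s, f i ∈ RV α β γ m) : ∑ i ∈ s, f i ∈ RV α β γ m := by
  refine mem_RV.2 fun t ht => ?_
  rw [map_sum]
  exact Finset.sum_eq_zero fun i hi => mem_RV.1 (hf i hi) t ht
end Equations

/-! ### 6.2 Isobaric components and indicator points -/
section Components
variable {α β γ : Type} [DecidableEq α] [DecidableEq β] [DecidableEq γ]

/-- The coordinate tensor carrying the values `v` on the cells of `P` (and `0` elsewhere) has rank `≤ |P|`.
[cite: LandsbergGCT2017, §8.3.4 (p. 227)] -/
theorem tensorRank_onCells_le (P : Finset (α × β × γ)) (v : α × β × γ → ℂ) :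
    tensorRank (fun a b c => if (a, b, c) ∈ P then v (a, b, c) else 0) ≤ P.card := by
  refine tensorRank_le_card_of_eq_finset_sum P (fun p => Pi.single p.1 (v p))
    (fun p => Pi.single p.2.1 1) (fun p => Pi.single p.2.2 1) ?_
  funext a b c
  rw [Finset.sum_apply, Finset.sum_apply, Finset.sum_apply]
  have hterm : ∀ q ∈ P, triad (Pi.single q.1 (v q)) (Pi.single q.2.1 (1 : ℂ))
      (Pi.single q.2.2 (1 : ℂ)) a b c = if (a, b, c) = q then v (a, b, c) else 0 := by
    rintro ⟨i, j, k⟩ _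
    rw [triad_apply, Pi.single_apply, Pi.single_apply, Pi.single_apply]
    by_cases hi : a = i
    · subst hi
      by_cases hj : b = j
      · subst hj
        by_cases hk : c = k
        · subst hk
          simp
        · simp [hk]
      · simp [hj]
    · simp [hi]
  rw [Finset.sum_congr rfl hterm, Finset.sum_ite_eq]

/-- The isobaric component of weight `w` of `f` (the sum of the terms of `f` of torus weight `w`). [bookkeeping] -/
noncomputable def isoComp (w : WIdx α β γ →₀ ℕ) (f : MvPolynomial (α × β × γ) ℂ) :
    MvPolynomial (α × β × γ) ℂ :=
  ∑ μ ∈ f.support.filter (fun μ => wt μ = w), MvPolynomial.monomial μ (f.coeff μ)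

/-- Coefficients of an isobaric component. [bookkeeping] -/
theorem coeff_isoComp (w : WIdx α β γ →₀ ℕ) (f : MvPolynomial (α × β × γ) ℂ)
    (ν : (α × β × γ) →₀ ℕ) : (isoComp w f).coeff ν = if wt ν = w then f.coeff ν else 0 := by
  unfold isoComp
  rw [MvPolynomial.coeff_sum]
  have hterm : ∀ μ ∈ f.support.filter (fun μ => wt μ = w),
      MvPolynomial.coeff ν (MvPolynomial.monomial μ (f.coeff μ)) =
        if ν = μ then f.coeff ν else 0 := by
    intro μ _
    rw [MvPolynomial.coeff_monomial]
    by_cases h : μ = ν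
    · subst h; simp
    · rw [if_neg h, if_neg (Ne.symm h)]
  rw [Finset.sum_congr rfl hterm, Finset.sum_ite_eq]
  by_cases hν : ν ∈ f.support
  · simp [Finset.mem_filter, hν]
  · have h0 : f.coeff ν = 0 := MvPolynomial.notMem_support_iff.1 hν
    simp [Finset.mem_filter, hν, h0]

/-- The support of an isobaric component lies in the support, in the prescribed weight. [bookkeeping] -/
theorem mem_support_isoComp {w : WIdx α β γ →₀ ℕ} {f : MvPolynomial (α × β × γ) ℂ}
    {ν : (α × β × γ) →₀ ℕ} (hν : ν ∈ (isoComp w f).support) : ν ∈ f.support ∧ wt ν = w := by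
  rw [MvPolynomial.mem_support_iff, coeff_isoComp] at hν
  by_cases h : wt ν = w
  · rw [if_pos h] at hν
    exact ⟨MvPolynomial.mem_support_iff.2 hν, h⟩
  · rw [if_neg h] at hν
    exact (hν rfl).elim

/-- Isobaric components are isobaric. [bookkeeping] -/
theorem isoComp_isobaric (w : WIdx α β γ →₀ ℕ) (f : MvPolynomial (α × β × γ) ℂ) :
    ∃ w', ∀ ν ∈ (isoComp w f).support, wt ν = w' :=
  ⟨w, fun _ hν => (mem_support_isoComp hν).2⟩

/-- Isobaric components do not raise the degree. [bookkeeping] -/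
theorem totalDegree_isoComp_le (w : WIdx α β γ →₀ ℕ) (f : MvPolynomial (α × β × γ) ℂ) :
    (isoComp w f).totalDegree ≤ f.totalDegree :=
  Finset.sup_mono (fun _ hν => (mem_support_isoComp hν).1)

/-- `f` is the sum of its isobaric components. [bookkeeping] -/
theorem sum_isoComp (f : MvPolynomial (α × β × γ) ℂ) :
    ∑ w ∈ f.support.image wt, isoComp w f = f := by
  ext ν
  rw [MvPolynomial.coeff_sum]
  simp_rw [coeff_isoComp]
  rw [Finset.sum_ite_eq]
  by_cases hν : ν ∈ f.support
  · rw [if_pos (Finset.mem_image_of_mem wt hν)]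
  · rw [MvPolynomial.notMem_support_iff.1 hν]
    split_ifs <;> rfl

/-- The `w`-coefficient of the torus substitution of `f` is the value at `t` of the isobaric component `f_w`.
[bookkeeping] -/
theorem coeff_aeval_torus (t : α → β → γ → ℂ) (f : MvPolynomial (α × β × γ) ℂ)
    (w : WIdx α β γ →₀ ℕ) :
    MvPolynomial.coeff w (MvPolynomial.aeval (fun p : α × β × γ =>
        MvPolynomial.monomial (cellWt p) (t p.1 p.2.1 p.2.2)) f) =
      MvPolynomial.aeval (fun p : α × β × γ => t p.1 p.2.1 p.2.2) (isoComp w f) := by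
  conv_lhs => rw [f.as_sum]
  rw [map_sum, MvPolynomial.coeff_sum]
  simp_rw [aeval_torus_monomial, MvPolynomial.coeff_monomial]
  unfold isoComp
  rw [map_sum, Finset.sum_filter]
  refine Finset.sum_congr rfl fun μ _ => ?_
  by_cases h : wt μ = w
  · rw [if_pos h, if_pos h, MvPolynomial.aeval_monomial, Algebra.algebraMap_self_apply]
  · rw [if_neg h, if_neg h]

/-- At the indicator point of a set of cells `S`, a polynomial evaluates to the plain sum of the coefficients
of its monomials supported inside `S`. [bookkeeping] -/
theorem aeval_indicator_eq_sum_coeff (S : Finset (α × β × γ)) (f : MvPolynomial (α × β × γ) ℂ) :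
    MvPolynomial.aeval (fun p : α × β × γ => if p ∈ S then (1 : ℂ) else 0) f =
      ∑ μ ∈ f.support.filter (fun μ => μ.support ⊆ S), f.coeff μ := by
  conv_lhs => rw [f.as_sum]
  rw [map_sum, Finset.sum_filter]
  refine Finset.sum_congr rfl fun μ _ => ?_
  rw [MvPolynomial.aeval_monomial, Algebra.algebraMap_self_apply, Finsupp.prod]
  by_cases hsub : μ.support ⊆ S
  · rw [if_pos hsub, Finset.prod_eq_one, mul_one]
    intro p hp
    rw [if_pos (hsub hp), one_pow]
  · obtain ⟨p, hpμ, hpS⟩ := Finset.not_subset.1 hsub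
    rw [if_neg hsub, Finset.prod_eq_zero hpμ, mul_zero]
    rw [if_neg hpS, zero_pow (Finsupp.mem_support_iff.1 hpμ)]
end Components

/-! ### 6.3 The support law, the torus-weight law, the isobaric reduction, the table formula -/
section Laws
variable {α β γ : Type} [Fintype α] [Fintype β] [Fintype γ] [DecidableEq α] [DecidableEq β]
  [DecidableEq γ] {m : ℕ}

/-- **L1 · Support law.** If `f` vanishes on every tensor of rank `≤ m`, the coefficient of any `μ` with `|supp μ| ≤ m`
is `0` (restrict `f` to the coordinate subspace `ℂ^{supp μ} ⊂ {R ≤ m}` and read off the `μ`-coefficient).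
[cite: LandsbergGCT2017, §8.3.4 (p. 227), monomial by monomial in all degrees] -/
theorem coeff_eq_zero_of_card_support_le {f : MvPolynomial (α × β × γ) ℂ} (hf : f ∈ RV α β γ m)
    {μ : (α × β × γ) →₀ ℕ} (hcardμ : μ.support.card ≤ m) : f.coeff μ = 0 := by
  classical
  by_contra hμ
  obtain ⟨P, hP⟩ : ∃ P : Finset (α × β × γ), P = μ.support := ⟨_, rfl⟩
  have hPcard : P.card ≤ m := hP ▸ hcardμ
  obtain ⟨φ, hφ⟩ : ∃ φ : α × β × γ → MvPolynomial (α × β × γ) ℂ,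
      φ = fun p => if p ∈ P then MvPolynomial.X p else 0 := ⟨_, rfl⟩
  have hg0 : MvPolynomial.aeval φ f = 0 := by
    apply MvPolynomial.funext
    intro v
    rw [map_zero, ← MvPolynomial.aeval_eq_eval, MvPolynomial.comp_aeval_apply]
    have hfun : (fun p => MvPolynomial.aeval v (φ p)) = fun p : α × β × γ =>
        (fun a b c => if (a, b, c) ∈ P then v (a, b, c) else 0) p.1 p.2.1 p.2.2 := by
      funext p
      obtain ⟨a, b, c⟩ := p
      rw [hφ]
      dsimp only
      split_ifs <;> simp
    have hrank : tensorRank (fun a b c => if (a, b, c) ∈ P then v (a, b, c) else 0) ≤ m :=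
      (tensorRank_onCells_le P v).trans hPcard
    rw [hfun]
    exact mem_RV.1 hf (fun a b c => if (a, b, c) ∈ P then v (a, b, c) else 0) hrank
  have hsum : MvPolynomial.aeval φ f =
      ∑ ν ∈ f.support, MvPolynomial.aeval φ (MvPolynomial.monomial ν (MvPolynomial.coeff ν f)) := by
    conv_lhs => rw [f.as_sum]
    rw [map_sum]
  have hterm : ∀ ν ∈ f.support,
      MvPolynomial.coeff μ (MvPolynomial.aeval φ (MvPolynomial.monomial ν (MvPolynomial.coeff ν f))) =
        if μ = ν then MvPolynomial.coeff μ f else 0 := by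
    intro ν hν
    rw [MvPolynomial.aeval_monomial, MvPolynomial.algebraMap_eq]
    by_cases hsub : ν.support ⊆ P
    · have hprod : (ν.prod fun i k => φ i ^ k) = MvPolynomial.monomial ν (1 : ℂ) := by
        rw [MvPolynomial.monomial_eq, MvPolynomial.C_1, one_mul, Finsupp.prod, Finsupp.prod]
        exact Finset.prod_congr rfl fun i hi => by
          rw [hφ]
          dsimp only
          rw [if_pos (hsub hi)]
      rw [hprod, MvPolynomial.C_mul_monomial, mul_one, MvPolynomial.coeff_monomial]
      by_cases hμν : ν = μ
      · subst hμν
        simp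
      · rw [if_neg hμν, if_neg (Ne.symm hμν)]
    · obtain ⟨i, hiν, hiP⟩ := Finset.not_subset.1 hsub
      have hzero : (ν.prod fun i k => φ i ^ k) = 0 := by
        rw [Finsupp.prod]
        apply Finset.prod_eq_zero hiν
        rw [hφ]
        dsimp only
        rw [if_neg hiP, zero_pow (Finsupp.mem_support_iff.1 hiν)]
      rw [hzero, mul_zero, MvPolynomial.coeff_zero, if_neg]
      rintro rfl
      exact hiP (hP ▸ hiν)
  have hcoeff : MvPolynomial.coeff μ (MvPolynomial.aeval φ f) = MvPolynomial.coeff μ f := by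
    rw [hsum, MvPolynomial.coeff_sum, Finset.sum_congr rfl hterm, Finset.sum_ite_eq,
      if_pos (MvPolynomial.mem_support_iff.2 hμ)]
  rw [hg0, MvPolynomial.coeff_zero] at hcoeff
  exact hμ hcoeff.symm

/-- **L1, support form**: every exponent in the support of an equation of `σ_m` has more than `m` cells.
-/
theorem lt_card_support_of_mem_support {f : MvPolynomial (α × β × γ) ℂ} (hf : f ∈ RV α β γ m)
    {μ : (α × β × γ) →₀ ℕ} (hμ : μ ∈ f.support) : m < μ.support.card := by
  by_contra hle
  exact (MvPolynomial.mem_support_iff.1 hμ) (coeff_eq_zero_of_card_support_le hf (not_lt.1 hle))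

/-- Corollary (rung R1 in any format): an equation of `σ_m` of total degree `≤ m` is `0`.
[cite: LandsbergGCT2017, Prop. 8.3.4.2 (p. 227)] -/
theorem eq_zero_of_totalDegree_le {f : MvPolynomial (α × β × γ) ℂ} (hf : f ∈ RV α β γ m)
    (hd : f.totalDegree ≤ m) : f = 0 := by
  classical
  ext μ
  rw [MvPolynomial.coeff_zero]
  by_contra hμ
  have hmem : μ ∈ f.support := MvPolynomial.mem_support_iff.2 hμ
  have hdeg : (μ.sum fun _ e => e) ≤ f.totalDegree := MvPolynomial.le_totalDegree hmem
  have hle : μ.support.card ≤ μ.sum fun _ e => e := by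
    rw [Finsupp.sum, Finset.card_eq_sum_ones]
    exact Finset.sum_le_sum fun i hi => Nat.one_le_iff_ne_zero.2 (Finsupp.mem_support_iff.1 hi)
  exact absurd (lt_card_support_of_mem_support hf hmem) (not_lt.2 (hle.trans (hdeg.trans hd)))

/-- Entries of the torus orbit point `(diag ξ, diag η, diag ζ)·t`. [folklore] -/
theorem actTensor_torus (ξ : α → ℂ) (η : β → ℂ) (ζ : γ → ℂ) (t : α → β → γ → ℂ) :
    actTensor (Matrix.diagonal ξ) (Matrix.diagonal η) (Matrix.diagonal ζ) t =
      fun a b c => ξ a * η b * ζ c * t a b c := by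
  funext a b c
  rw [actTensor_apply, Finset.sum_eq_single a, Finset.sum_eq_single b, Finset.sum_eq_single c]
  · simp only [Matrix.diagonal_apply_eq]
  all_goals first
    | exact fun h => (h (Finset.mem_univ _)).elim
    | (intro k _ hk; simp [Matrix.diagonal_apply_ne _ (Ne.symm hk)])

/-- Evaluating the torus substitution of `f` at `ξ ⊕ η ⊕ ζ` evaluates `f` at `(diag ξ, diag η, diag ζ)·t`. [bookkeeping] -/
theorem eval_aeval_torus (t : α → β → γ → ℂ) (f : MvPolynomial (α × β × γ) ℂ) (x : WIdx α β γ → ℂ) :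
    MvPolynomial.eval x (MvPolynomial.aeval (fun p : α × β × γ =>
        MvPolynomial.monomial (cellWt p) (t p.1 p.2.1 p.2.2)) f) =
      MvPolynomial.aeval (fun p : α × β × γ =>
        actTensor (Matrix.diagonal fun a => x (Sum.inl a)) (Matrix.diagonal fun b => x (Sum.inr (Sum.inl b)))
          (Matrix.diagonal fun c => x (Sum.inr (Sum.inr c))) t p.1 p.2.1 p.2.2) f := by
  classical
  rw [← MvPolynomial.aeval_eq_eval, MvPolynomial.comp_aeval_apply, actTensor_torus]
  have hfun : (fun p : α × β × γ => MvPolynomial.aeval x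
      (MvPolynomial.monomial (cellWt p) (t p.1 p.2.1 p.2.2))) = fun p : α × β × γ =>
        (fun a b c => x (Sum.inl a) * x (Sum.inr (Sum.inl b)) * x (Sum.inr (Sum.inr c)) * t a b c)
          p.1 p.2.1 p.2.2 := by
    funext p
    rw [MvPolynomial.aeval_monomial, cellWt, Finsupp.prod_add_index', Finsupp.prod_add_index',
      Finsupp.prod_single_index, Finsupp.prod_single_index, Finsupp.prod_single_index]
    · rw [pow_one, pow_one, pow_one, Algebra.algebraMap_self_apply]
      ring
    all_goals first
      | exact pow_zero _
      | (intro a; exact pow_zero _)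
      | (intro a b₁ b₂; exact pow_add _ _ _)
  rw [hfun]

/-- **L2 · Torus-weight law.** If `f` vanishes on every tensor of rank `≤ m`, so does each isobaric component: `{R ≤ m}` is
torus-stable, so `f((diag ξ, diag η, diag ζ)·t) = Σ_w (ξ,η,ζ)^w · f_w(t)` vanishes identically in `ξ,η,ζ`, hence coefficientwise.
[cite: LandsbergGCT2017, §7.1 (p. 218)] [cite: Blaser2013, Lemma 5.4] -/
theorem isoComp_mem_RV {f : MvPolynomial (α × β × γ) ℂ} (hf : f ∈ RV α β γ m) (w : WIdx α β γ →₀ ℕ) :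
    isoComp w f ∈ RV α β γ m := by
  classical
  refine mem_RV.2 fun t ht => ?_
  have hQ : MvPolynomial.aeval (fun p : α × β × γ =>
      MvPolynomial.monomial (cellWt p) (t p.1 p.2.1 p.2.2)) f = 0 := by
    apply MvPolynomial.funext
    intro x
    rw [map_zero, eval_aeval_torus]
    exact mem_RV.1 hf (actTensor (Matrix.diagonal fun a => x (Sum.inl a))
      (Matrix.diagonal fun b => x (Sum.inr (Sum.inl b))) (Matrix.diagonal fun c => x (Sum.inr (Sum.inr c))) t)
      ((tensorRestrictsTo_actTensor _ _ _ t).tensorRank_le.trans ht)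
  rw [← coeff_aeval_torus, hQ, MvPolynomial.coeff_zero]

/-- **Isobaric reduction** (pointwise): if every ISOBARIC equation of `σ_m` of degree `≤ D` vanishes at `x`, then every
equation of `σ_m` of degree `≤ D` vanishes at `x`. -/
theorem aeval_eq_zero_of_isobaric {D : ℕ} (x : α × β × γ → ℂ)
    (H : ∀ g : MvPolynomial (α × β × γ) ℂ, (∃ w, ∀ μ ∈ g.support, wt μ = w) → g.totalDegree ≤ D →
      g ∈ RV α β γ m → MvPolynomial.aeval x g = 0)
    {f : MvPolynomial (α × β × γ) ℂ} (hd : f.totalDegree ≤ D) (hf : f ∈ RV α β γ m) :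
    MvPolynomial.aeval x f = 0 := by
  classical
  have hsplit : MvPolynomial.aeval x f = ∑ w ∈ f.support.image wt, MvPolynomial.aeval x (isoComp w f) := by
    conv_lhs => rw [← sum_isoComp f]
    rw [map_sum]
  rw [hsplit]
  exact Finset.sum_eq_zero fun w _ =>
    H _ (isoComp_isobaric w f) ((totalDegree_isoComp_le w f).trans hd) (isoComp_mem_RV hf w)

/-- **L3 · Table formula (with L1)**: at the indicator point of `S`, an equation of `σ_m` evaluates to the plain sum of the
coefficients of its monomials supported inside `S` on MORE THAN `m` distinct cells. -/
theorem aeval_indicator_eq_sum_coeff_large (S : Finset (α × β × γ)) {f : MvPolynomial (α × β × γ) ℂ}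
    (hf : f ∈ RV α β γ m) :
    MvPolynomial.aeval (fun p : α × β × γ => if p ∈ S then (1 : ℂ) else 0) f =
      ∑ μ ∈ f.support.filter (fun μ => μ.support ⊆ S ∧ m < μ.support.card), f.coeff μ := by
  classical
  rw [aeval_indicator_eq_sum_coeff]
  refine Finset.sum_congr ?_ fun _ _ => rfl
  ext μ
  simp only [Finset.mem_filter]
  constructor
  · rintro ⟨hμ, hsub⟩
    exact ⟨hμ, hsub, lt_card_support_of_mem_support hf hμ⟩
  · rintro ⟨hμ, hsub, _⟩
    exact ⟨hμ, hsub⟩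
end Laws

end Summit.MatrixMultiplication.MatrixMultiplication.Theorems.ObstructionDescentTorusLaws

end
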